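import Mathlib
import HarnessLib
import Literature.MathematicalPhysics.KineticTheory.VelocityFlipNoise
import Literature.MathematicalPhysics.KineticTheory.VelocityFlipGroup
import Literature.MathematicalPhysics.KineticTheory.LangevinChainHormander
import Literature.Analysis.Hypoelliptic.CoupledSystem
import Literature.Analysis.Hypoelliptic.EquivTransport
import Literature.Analysis.Distribution.BracketSpanRescale
import Summits.AtomisticToContinuum.FouriersLaw.Theorems.VanishingNoiseTransferVanishingNoiseBoundFlipWeakToClassical

/-!
# `C^∞`-hypoellipticity of the flip-noisy Langevin generator `L + εS` (stub HYPO of line `fekete-usc-one-length`)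

`--supports stmt-AtomisticToContinuum-11976` file closing the registered stub `stub_flipHypoelliptic` (HYPO) of the
skeleton of line `fekete-usc-one-length`, crux `VanishingNoiseBound`
(`Summit.AtomisticToContinuum.FouriersLaw.Theses.VanishingNoiseTransfer.VanishingNoiseBound`), route
`VanishingNoiseTransfer`, sub-problem `FouriersLaw`. HYPO is clause (i)'s regularity input of the dual Kubo road:
a measurable, exponentially energy-bounded weak solution `u` of `(L_{T_L,T_R} + εS) u = F` (`F ∈ C^∞`, Lebesgue-
transposed form) of ONE finite pinned chain with velocity flips at rate `ε ≥ 0` is a.e. a smooth function.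

Proof (Hörmander–Kohn for a square system). The velocity-flip noise `S u = ∑_i (u ∘ ·^i − u)` is a zeroth-order
but NONLOCAL perturbation of the hypoelliptic generator `L = Y·∇ + X_L² + X_R²`, so Hörmander's theorem does not
apply verbatim. The `2^L` flip conjugates `u ∘ ·^w`, `w ⊆ Fin L` (multi-site flips, the group `(ℤ/2)^L`
generated by the `·^i`: `Literature/MathematicalPhysics/KineticTheory/VelocityFlipGroup.lean`), solve the square system
`P_w (u∘·^w) = F∘·^w + εL·(u∘·^w) − ε ∑_i u∘·^{w∆{i}}` (`flip_weak_conj`) whose operators `P_w` — `L` conjugated by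
the linear measure-preserving flip `·^w` (`Literature.Analysis.Hypoelliptic.hormanderTranspose_comp_equiv`) — are
sums of squares of the (flipped, constant) bath fields plus the conjugated drift, satisfying Hörmander's bracket
condition (`isBracketGenerating_driftFamily` = CEHR Prop. 4.1 up to the sign of the drift, transported by
`isBracketGenerating_conj_equiv_elim`). Square systems with diagonal Hörmander principal part and constant
zeroth-order coupling are hypoelliptic: `Literature.Analysis.Hypoelliptic.exists_smooth_ae_eq_of_coupledSystem`
(`Literature/Analysis/Hypoelliptic/CoupledSystem.lean`, Kohn's Fourier-side bootstrap of `HormanderProof.lean` run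
jointly over the components). The component `w = ∅` is `u`.

* `transposedGenerator_eq_hormanderTranspose` — the test-side operator
  `−Lφ + 2γ(T_L∂²_{p_0} + T_R∂²_{p_{N−1}})φ + 2γφ` IS `ᵗL = hormanderTranspose Y (X_L, X_R) 0`;
* `isBracketGenerating_driftFamily` — the bracket condition for `(Y, X_L, X_R)`;
* `flip_weak_conj`, `flip_coupling_sum` — the coupled system of the flip conjugates;
* `stub_flipHypoelliptic` — the registered signature.

References: L. Hörmander, Acta Math. 119 (1967) Thm 1.1; J. J. Kohn, Proc. Sympos. Pure Math. 23 (1973) 61–69;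
M. E. Taylor, *Pseudodifferential Operators* (1981) Ch. XV §1; B. Helffer, F. Nier, LNM 1862 (2005) §2;
N. Cuneo, J.-P. Eckmann, M. Hairer, L. Rey-Bellet, EJP 23 (2018) §3.1, Prop. 4.1; C. Bernardin, S. Olla,
J. Stat. Phys. 145 (2011) §2.1.
-/

noncomputable section

namespace Summit.AtomisticToContinuum.FouriersLaw.Theorems.VanishingNoiseBound

open MeasureTheory Filter Topology Set Function
open scoped ContDiff
open Literature.MathematicalPhysics.KineticTheory.HeatConduction
open Literature.Analysis.Distribution Literature.Analysis.Hypoelliptic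

variable {N : ℕ}

/-! ## The Lebesgue-transposed generator in Hörmander's form `(Y, X_L, X_R; c = 0)` -/

/-- `div(−Y) = 2γ` for an oscillator chain with smooth potentials (`N ≥ 1`). -/
theorem fieldDiv_adjointDrift_eq (P : OscillatorChain) (hU : ContDiff ℝ ∞ P.U) (hV : ContDiff ℝ ∞ P.V)
    (hN : 0 < N) (x : PhaseSpace N) : fieldDiv (P.adjointDrift N) x = 2 * P.γ := by
  have h1 : P.adjointDrift N = fun y => -P.drift N y := rfl
  rw [fieldDiv, h1, fderiv_fun_neg]
  simp only [ContinuousLinearMap.toLinearMap_neg, map_neg]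
  rw [show LinearMap.trace ℝ _ (fderiv ℝ (P.drift N) x : PhaseSpace N →ₗ[ℝ] PhaseSpace N) =
    fieldDiv (P.drift N) x from rfl, P.fieldDiv_drift hU hV hN]
  ring

/-- **The test-side operator of the Lebesgue-transposed weak form is `ᵗL` in Hörmander's form**:
`−Lf + 2γ(T_L ∂²_{p_0} f + T_R ∂²_{p_{N−1}} f) + 2γ f = hormanderTranspose Y (X_L, X_R) 0 f` with the drift
`Y = OscillatorChain.drift` and the constant bath fields `X_b = √(γT_b) ∂_{p_b}` (smooth potentials, `N ≥ 1`,
`γT_b ≥ 0`). [CEHR 2018 §3.1; Hörmander 1967 (1.6)] -/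
theorem transposedGenerator_eq_hormanderTranspose (P : OscillatorChain) (hU : ContDiff ℝ ∞ P.U)
    (hV : ContDiff ℝ ∞ P.V) (hN : 0 < N) {T_L T_R : ℝ} (hL : 0 ≤ P.γ * T_L) (hR : 0 ≤ P.γ * T_R)
    {f : PhaseSpace N → ℝ} (hf : ContDiff ℝ ∞ f) (x : PhaseSpace N) :
    -(P.generator N T_L T_R f x) +
        2 * P.γ * (T_L * partialP (⟨0, hN⟩ : Fin N) (partialP (⟨0, hN⟩ : Fin N) f) x +
          T_R * partialP (⟨N - 1, Nat.sub_lt hN one_pos⟩ : Fin N)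
            (partialP (⟨N - 1, Nat.sub_lt hN one_pos⟩ : Fin N) f) x) +
        2 * P.γ * f x =
      hormanderTranspose (P.drift N) (P.bathField hN T_L T_R) (fun _ => 0) f x := by
  have h1 : hormanderTranspose (P.drift N) (P.bathField hN T_L T_R) (fun _ => 0) f x =
      P.generator N T_L T_R f x - 2 * fderiv ℝ f x (P.drift N x) + 2 * P.γ * f x := by
    rw [← P.hormanderTranspose_eq_generator hU hV hN hL hR hf]
    simp only [hormanderTranspose]
    have hdiv : fieldDiv (P.drift N) x = -(2 * P.γ) := P.fieldDiv_drift hU hV hN x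
    have hdiv' : fieldDiv (P.adjointDrift N) x = 2 * P.γ := fieldDiv_adjointDrift_eq P hU hV hN x
    have had : P.adjointDrift N x = -P.drift N x := rfl
    simp only [fieldTranspose, fieldDeriv, hdiv, hdiv', had, map_neg]
    ring
  have h2 := P.generator_eq_fderiv_drift_add N T_L T_R (hf.differentiable (by simp)) x
  rw [sum_bathTemps_mul_partialP' hN] at h2
  rw [h1]
  linear_combination (-2 : ℝ) * h2

/-- **Hörmander's bracket condition for the generator's own family `(Y, X_L, X_R)`** (smooth potentials,
`V″ ≠ 0`, `γT_L > 0`, `N ≥ 1`): it differs from CEHR's family `(−Y, X_L, X_R)`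
(`isBracketGenerating_hormanderFamily`) by the sign of the drift, and the bracket condition is invariant under
non-zero rescaling of the fields. [CEHR 2018 Prop. 4.1] -/
theorem isBracketGenerating_driftFamily (P : OscillatorChain) (hU : ContDiff ℝ ∞ P.U) (hV : ContDiff ℝ ∞ P.V)
    (hN : 0 < N) {T_L T_R : ℝ} (hγL : 0 < P.γ * T_L) (hV2 : ∀ r, deriv (deriv P.V) r ≠ 0) :
    IsBracketGenerating (fun o : Option (Fin 2) => o.elim (P.drift N) (P.bathField hN T_L T_R)) univ := by
  have hX : ∀ o : Option (Fin 2), ContDiff ℝ ∞ (P.hormanderFamily hN T_L T_R o) := by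
    rintro (_ | b)
    · exact P.contDiff_adjointDrift hU hV N
    · exact contDiff_const
  have hX' : ∀ o : Option (Fin 2),
      (fun o : Option (Fin 2) => o.elim (P.drift N) (P.bathField hN T_L T_R)) o =
        (fun o : Option (Fin 2) => o.elim (-1 : ℝ) (fun _ => 1)) o • P.hormanderFamily hN T_L T_R o := by
    rintro (_ | b)
    · funext y
      simp [OscillatorChain.hormanderFamily, OscillatorChain.adjointDrift]
    · funext y
      simp [OscillatorChain.hormanderFamily]
  have hc : ∀ o : Option (Fin 2), (fun o : Option (Fin 2) => o.elim (-1 : ℝ) (fun _ => 1)) o ≠ 0 := by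
    rintro (_ | b) <;> simp
  exact (isBracketGenerating_iff_of_eq_smul hX hX' hc univ).2
    (P.isBracketGenerating_hormanderFamily hN T_L T_R hU hV hγL hV2)

/-! ## The flip conjugates of a weak solution solve a coupled Hörmander system -/

section Conj

variable {ω₂ lam β γ : ℝ} {L : ℕ}

/-- A measurable, exponentially energy-bounded function stays locally integrable after composition with a
continuous map (the flips). -/
theorem locallyIntegrable_comp_of_exp_bound {u : PhaseSpace L → ℝ} (hum : Measurable u)
    (hub : ∃ C θ : ℝ, ∀ x, |u x| ≤ C * Real.exp (θ * (pinnedChain ω₂ lam β γ).hamiltonian L x))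
    {Ψ : PhaseSpace L → PhaseSpace L} (hΨ : Continuous Ψ) :
    LocallyIntegrable (fun x => u (Ψ x)) volume := by
  obtain ⟨C, θ, hC⟩ := hub
  have hHc : Continuous ((pinnedChain ω₂ lam β γ).hamiltonian L) := pinnedChain_continuous_hamiltonian ω₂ lam β γ L
  have hb : Continuous fun x => |C| * Real.exp (θ * (pinnedChain ω₂ lam β γ).hamiltonian L (Ψ x)) :=
    continuous_const.mul (Real.continuous_exp.comp (continuous_const.mul (hHc.comp hΨ)))
  refine hb.locallyIntegrable.mono (hum.comp hΨ.measurable).aestronglyMeasurable (ae_of_all _ fun x => ?_)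
  have h0 : 0 ≤ |C| * Real.exp (θ * (pinnedChain ω₂ lam β γ).hamiltonian L (Ψ x)) := by positivity
  rw [Real.norm_eq_abs, Real.norm_eq_abs, abs_of_nonneg h0]
  exact (hC _).trans (mul_le_mul_of_nonneg_right (le_abs_self C) (Real.exp_pos _).le)

/-- **The flip conjugates of a weak solution of `(L + εS) u = F` solve the conjugated equations.** With the
multi-site flips `ω ↦ ω^w` (`Φ`, `hΦ`; `Fw` the flip `ω^w` as a linear equivalence), the Lebesgue-transposed weak
form of `(L_{T_L,T_R} + εS) u = F` for an exponentially bounded measurable `u` gives, for every `w ⊆ Fin L` and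
every test function `φ`:
`∫ (u∘·^w) ᵗP_w φ = ∫ (F∘·^w) φ + εL ∫ (u∘·^w) φ − ε ∑_i ∫ (u∘·^{w∆{i}}) φ`, where `P_w` is the generator
conjugated by `·^w` (drift `Fw ∘ Y ∘ Fw`, bath fields `Fw X_b`). Ingredients: the weak form tested against
`φ ∘ ·^w`, `transposedGenerator_eq_hormanderTranspose`, `hormanderTranspose_comp_equiv`, the commutation of the
flips (`momentumFlip_multiFlip`), and the invariance of Lebesgue measure under `·^w` and `·^i`. -/
theorem flip_weak_conj (hL : 2 ≤ L) {T_L T_R ε : ℝ} (hTL : 0 < T_L) (hTR : 0 < T_R) (hγ : 0 < γ)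
    (Φ : Finset (Fin L) → PhaseSpace L → PhaseSpace L)
    (hΦ : ∀ w x, Φ w x = (x.1, fun j => if j ∈ w then -x.2 j else x.2 j))
    {u F : PhaseSpace L → ℝ} (hum : Measurable u)
    (hub : ∃ C θ : ℝ, ∀ x, |u x| ≤ C * Real.exp (θ * (pinnedChain ω₂ lam β γ).hamiltonian L x))
    (hweak : ∀ φ : PhaseSpace L → ℝ, ContDiff ℝ ∞ φ → HasCompactSupport φ →
      ∫ x, u x * (-((pinnedChain ω₂ lam β γ).generator L T_L T_R φ x) +
          2 * γ * (T_L * partialP (⟨0, by omega⟩ : Fin L) (partialP (⟨0, by omega⟩ : Fin L) φ) x +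
            T_R * partialP (⟨L - 1, by omega⟩ : Fin L) (partialP (⟨L - 1, by omega⟩ : Fin L) φ) x) +
          2 * γ * φ x + ε * flipNoise L φ x) = ∫ x, F x * φ x)
    (w : Finset (Fin L)) (Fw : PhaseSpace L ≃L[ℝ] PhaseSpace L) (hFw : ∀ x, Fw x = Φ w x)
    {φ : PhaseSpace L → ℝ} (hφ : ContDiff ℝ ∞ φ) (hφc : HasCompactSupport φ) :
    ∫ x, u (Φ w x) * hormanderTranspose (fun y => Fw ((pinnedChain ω₂ lam β γ).drift L (Fw.symm y)))
        (fun b y => Fw ((pinnedChain ω₂ lam β γ).bathField (Nat.zero_lt_of_lt hL) T_L T_R b (Fw.symm y)))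
        (fun _ => 0) φ x =
      (∫ x, F (Φ w x) * φ x) +
        (ε * L * (∫ x, u (Φ w x) * φ x) - ε * ∑ i : Fin L, ∫ x, u (Φ (symmDiff w {i}) x) * φ x) := by
  set P := pinnedChain ω₂ lam β γ with hP
  have hL0 : 0 < L := Nat.zero_lt_of_lt hL
  have hU : ContDiff ℝ ∞ P.U := pinnedChain_contDiff_U ω₂ lam β γ
  have hV : ContDiff ℝ ∞ P.V := pinnedChain_contDiff_V ω₂ lam β γ
  have hγ' : P.γ = γ := rfl
  have hγL : 0 ≤ P.γ * T_L := by rw [hγ']; positivity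
  have hγR : 0 ≤ P.γ * T_R := by rw [hγ']; positivity
  have hY : ContDiff ℝ ∞ (P.drift L) := P.contDiff_drift hU hV L
  have hX : ∀ b, ContDiff ℝ ∞ (P.bathField hL0 T_L T_R b) := fun _ => contDiff_const
  -- integrability of `u ∘ ·^w'` against continuous compactly supported functions
  have hint : ∀ (w' : Finset (Fin L)) {ψ : PhaseSpace L → ℝ}, Continuous ψ → HasCompactSupport ψ →
      Integrable (fun x => u (Φ w' x) * ψ x) := by
    intro w' ψ hψ hψc
    have hl := locallyIntegrable_comp_of_exp_bound hum hub (continuous_multiFlip Φ hΦ w')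
    have := hl.integrable_smul_right_of_hasCompactSupport hψ hψc
    simpa only [smul_eq_mul] using this
  -- the flipped test function `φ ∘ ·^w`
  set φw : PhaseSpace L → ℝ := fun x => φ (Fw x) with hφw
  have hφws : ContDiff ℝ ∞ φw := hφ.comp Fw.contDiff
  have hφwc : HasCompactSupport φw := hφc.comp_homeomorph Fw.toHomeomorph
  have hw' := hweak φw hφws hφwc
  -- the conjugated operator applied to `φ`
  set Tφ : PhaseSpace L → ℝ := hormanderTranspose (fun y => Fw (P.drift L (Fw.symm y)))
      (fun b y => Fw (P.bathField hL0 T_L T_R b (Fw.symm y))) (fun _ => 0) φ with hTφ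
  have hTφs : ContDiff ℝ ∞ Tφ := contDiff_hormanderTranspose (contDiff_conj_equiv Fw hY)
    (fun b => contDiff_conj_equiv Fw (hX b)) contDiff_const hφ
  have hTφc : HasCompactSupport Tφ :=
    hφc.mono' ((subset_tsupport _).trans (tsupport_hormanderTranspose_subset _ _ _ φ))
  -- pointwise: the test-side integrand against `φ ∘ ·^w` is `(Tφ + ε Sφ) ∘ ·^w`
  have hFF : ∀ x, Fw (Fw x) = x := fun x => by rw [hFw, hFw, multiFlip_multiFlip Φ hΦ]
  have h2 : ∀ x, hormanderTranspose (P.drift L) (P.bathField hL0 T_L T_R) (fun _ => 0) φw x = Tφ (Fw x) :=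
    fun x => hormanderTranspose_comp_equiv Fw hY hX (fun _ => (0 : ℝ)) hφ x
  have h3 : ∀ x, flipNoise L φw x = flipNoise L φ (Fw x) := by
    intro x
    simp only [flipNoise_eq, hφw]
    refine Finset.sum_congr rfl fun i _ => ?_
    rw [hFw (momentumFlip i x), ← momentumFlip_multiFlip Φ hΦ, ← hFw]
  have hpt : ∀ x, u x * (-(P.generator L T_L T_R φw x) +
      2 * γ * (T_L * partialP (⟨0, by omega⟩ : Fin L) (partialP (⟨0, by omega⟩ : Fin L) φw) x +
        T_R * partialP (⟨L - 1, by omega⟩ : Fin L) (partialP (⟨L - 1, by omega⟩ : Fin L) φw) x) +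
      2 * γ * φw x + ε * flipNoise L φw x) = u x * (Tφ (Fw x) + ε * flipNoise L φ (Fw x)) := by
    intro x
    have h1 := transposedGenerator_eq_hormanderTranspose P hU hV hL0 hγL hγR hφws x
    rw [hγ'] at h1
    rw [← h3 x, ← h2 x, ← h1]
  rw [integral_congr_ae (ae_of_all _ hpt)] at hw'
  simp only [hφw, hFw] at hw'
  -- change of variables `x = y^w` on both sides
  have hw3 : ∫ y, u (Φ w y) * (Tφ y + ε * flipNoise L φ y) = ∫ y, F (Φ w y) * φ y := by
    rw [← integral_comp_multiFlip Φ hΦ w (fun y => u (Φ w y) * (Tφ y + ε * flipNoise L φ y)),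
      ← integral_comp_multiFlip Φ hΦ w (fun y => F (Φ w y) * φ y)]
    simp only [multiFlip_multiFlip Φ hΦ]
    exact hw'
  -- split the left-hand side
  have hφFc : ∀ i : Fin L, HasCompactSupport fun x => φ (momentumFlip i x) := by
    intro i
    let e : PhaseSpace L ≃ₜ PhaseSpace L :=
      { toFun := momentumFlip i, invFun := momentumFlip i, left_inv := momentumFlip_momentumFlip i,
        right_inv := momentumFlip_momentumFlip i, continuous_toFun := continuous_momentumFlip i,
        continuous_invFun := continuous_momentumFlip i }
    exact hφc.comp_homeomorph e
  have iT : Integrable (fun y => u (Φ w y) * Tφ y) := hint w hTφs.continuous hTφc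
  have iφ : Integrable (fun y => u (Φ w y) * φ y) := hint w hφ.continuous hφc
  have iφi : ∀ i, Integrable (fun y => u (Φ w y) * φ (momentumFlip i y)) := fun i =>
    hint w (hφ.continuous.comp (continuous_momentumFlip i)) (hφFc i)
  have e5 : (fun y => u (Φ w y) * (Tφ y + ε * flipNoise L φ y)) = fun y => u (Φ w y) * Tφ y +
      ε * ((∑ i, u (Φ w y) * φ (momentumFlip i y)) - L * (u (Φ w y) * φ y)) := by
    funext y
    have hs : u (Φ w y) * ∑ i, φ (momentumFlip i y) = ∑ i, u (Φ w y) * φ (momentumFlip i y) :=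
      Finset.mul_sum _ _ _
    rw [flipNoise_eq, Finset.sum_sub_distrib, Finset.sum_const, Finset.card_univ, Fintype.card_fin,
      nsmul_eq_mul]
    linear_combination ε * hs
  have iSum : Integrable (fun y => (∑ i, u (Φ w y) * φ (momentumFlip i y)) - L * (u (Φ w y) * φ y)) :=
    (integrable_finsetSum _ fun i _ => iφi i).sub (iφ.const_mul _)
  rw [e5, integral_add iT (iSum.const_mul ε), integral_const_mul,
    integral_sub (integrable_finsetSum _ fun i _ => iφi i) (iφ.const_mul _), integral_const_mul,
    integral_finsetSum _ fun i _ => iφi i] at hw3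
  -- `∫ (u∘·^w) (φ∘·^i) = ∫ (u∘·^{w∆{i}}) φ`
  have e6 : ∀ i, ∫ y, u (Φ w y) * φ (momentumFlip i y) = ∫ y, u (Φ (symmDiff w {i}) y) * φ y := by
    intro i
    rw [← integral_comp_momentumFlip (measurePreserving_momentumFlip_volume i)
      (fun y => u (Φ (symmDiff w {i}) y) * φ y)]
    refine integral_congr_ae (ae_of_all _ fun y => ?_)
    dsimp only
    rw [← multiFlip_momentumFlip Φ hΦ w i (momentumFlip i y), momentumFlip_momentumFlip]
  simp only [e6] at hw3
  have hw4 : (∫ y, u (Φ w y) * Tφ y) +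
      ε * ((∑ i, ∫ y, u (Φ (symmDiff w {i}) y) * φ y) - L * ∫ y, u (Φ w y) * φ y) =
      ∫ y, F (Φ w y) * φ y := hw3
  linear_combination hw4

/-- The coupling coefficients of the flip system: `∑_{w'} (c[w'=w] − ε ∑_i [w' = w ∆ {i}]) I_{w'} =
c I_w − ε ∑_i I_{w∆{i}}`. -/
theorem flip_coupling_sum (ε c : ℝ) (w : Finset (Fin L)) (I : Finset (Fin L) → ℝ) :
    ∑ w', (c * (if w' = w then 1 else 0) - ε * ∑ i : Fin L, (if w' = symmDiff w {i} then 1 else 0)) * I w' =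
      c * I w - ε * ∑ i : Fin L, I (symmDiff w {i}) := by
  have h1 : ∀ w', (c * (if w' = w then 1 else 0) - ε * ∑ i : Fin L, (if w' = symmDiff w {i} then 1 else 0)) * I w' =
      c * (if w' = w then I w' else 0) - ε * ∑ i : Fin L, (if w' = symmDiff w {i} then I w' else 0) := by
    intro w'
    have h2 : (∑ i : Fin L, (if w' = symmDiff w {i} then (1 : ℝ) else 0)) * I w' =
        ∑ i : Fin L, (if w' = symmDiff w {i} then I w' else 0) := by
      rw [Finset.sum_mul]
      exact Finset.sum_congr rfl fun i _ => by split_ifs <;> simp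
    have h3 : (if w' = w then (1 : ℝ) else 0) * I w' = if w' = w then I w' else 0 := by split_ifs <;> simp
    rw [← h2, ← h3]
    ring
  rw [Finset.sum_congr rfl fun w' _ => h1 w', Finset.sum_sub_distrib, ← Finset.mul_sum, ← Finset.mul_sum,
    Finset.sum_comm]
  simp only [Finset.sum_ite_eq', Finset.mem_univ, if_true]

end Conj

/-! ## The registered stub HYPO -/

/-- **Stub HYPO of line `fekete-usc-one-length` (crux `VanishingNoiseBound`): `C^∞`-hypoellipticity of the
flip-noisy Langevin generator `L + εS`.** For the pinned chain (all parameters `> 0`), `L ≥ 2`, bath temperatures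
`T_L, T_R > 0` and a flip rate `ε ≥ 0`: every measurable, exponentially energy-bounded `u` solving
`(L_{T_L,T_R} + εS) u = F` in the Lebesgue-transposed weak sense with `F ∈ C^∞` agrees a.e. with a smooth
function. Proof: the `2^L` flip conjugates `u ∘ ·^w` solve the square system
`P_w (u∘·^w) = F∘·^w + εL (u∘·^w) − ε ∑_i u∘·^{w∆{i}}` (`flip_weak_conj`), whose operators `P_w` — the
generator conjugated by the linear flips — are sums of squares plus a drift satisfying Hörmander's bracket
condition (`isBracketGenerating_driftFamily`, transported by `isBracketGenerating_conj_equiv_elim`); such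
diagonal systems with constant zeroth-order coupling are hypoelliptic
(`Literature.Analysis.Hypoelliptic.exists_smooth_ae_eq_of_coupledSystem`, Kohn's bootstrap run jointly over
the components), and the component `w = ∅` is `u` itself. [Hörmander 1967 Thm 1.1; Kohn 1973; Taylor 1981
Ch. XV §1; Helffer–Nier 2005 §2] -/
theorem stub_flipHypoelliptic :
    ∀ (ω₂ lam β γ : ℝ), 0 < ω₂ → 0 < lam → 0 < β → 0 < γ → ∀ (L : ℕ) (hL : 2 ≤ L) (T_L T_R ε : ℝ),
      0 < T_L → 0 < T_R → 0 ≤ ε → ∀ (u F : PhaseSpace L → ℝ), Measurable u →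
      (∃ C θ : ℝ, ∀ x, |u x| ≤ C * Real.exp (θ * (pinnedChain ω₂ lam β γ).hamiltonian L x)) →
      ContDiff ℝ ((⊤ : ℕ∞) : WithTop ℕ∞) F →
      (∀ φ : PhaseSpace L → ℝ, ContDiff ℝ ((⊤ : ℕ∞) : WithTop ℕ∞) φ → HasCompactSupport φ →
        ∫ x, u x * (-((pinnedChain ω₂ lam β γ).generator L T_L T_R φ x) +
            2 * γ * (T_L * partialP (⟨0, by omega⟩ : Fin L) (partialP (⟨0, by omega⟩ : Fin L) φ) x +
              T_R * partialP (⟨L - 1, by omega⟩ : Fin L) (partialP (⟨L - 1, by omega⟩ : Fin L) φ) x) +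
            2 * γ * φ x + ε * flipNoise L φ x) =
          ∫ x, F x * φ x) →
      ∃ v : PhaseSpace L → ℝ, ContDiff ℝ ((⊤ : ℕ∞) : WithTop ℕ∞) v ∧ ∀ᵐ x ∂(volume : Measure (PhaseSpace L)),
        u x = v x := by
  intro ω₂ lam β γ hω hl hβ hγ L hL T_L T_R ε hTL hTR _hε u F hum hub hF hweak
  set P := pinnedChain ω₂ lam β γ with hP
  have hL0 : 0 < L := Nat.zero_lt_of_lt hL
  have hU : ContDiff ℝ ∞ P.U := pinnedChain_contDiff_U ω₂ lam β γ
  have hV : ContDiff ℝ ∞ P.V := pinnedChain_contDiff_V ω₂ lam β γ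
  have hγ' : P.γ = γ := rfl
  have hγTL : 0 < P.γ * T_L := by rw [hγ']; positivity
  have hV2 : ∀ r, deriv (deriv P.V) r ≠ 0 := fun r => by
    rw [hP, pinnedChain_deriv_deriv_V]; positivity
  have hY : ContDiff ℝ ∞ (P.drift L) := P.contDiff_drift hU hV L
  have hX : ∀ b, ContDiff ℝ ∞ (P.bathField hL0 T_L T_R b) := fun _ => contDiff_const
  -- the multi-site flips and their linear equivalences
  set Φ : Finset (Fin L) → PhaseSpace L → PhaseSpace L :=
    fun w x => (x.1, fun j => if j ∈ w then -x.2 j else x.2 j) with hΦdef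
  have hΦ : ∀ w x, Φ w x = (x.1, fun j => if j ∈ w then -x.2 j else x.2 j) := fun w x => rfl
  have hex : ∀ w : Finset (Fin L), ∃ Fw : PhaseSpace L ≃L[ℝ] PhaseSpace L, ∀ x, Fw x = Φ w x := fun w =>
    (exists_multiFlip_equiv Φ hΦ w).imp fun _ h => h.1
  choose Fw hFw using hex
  -- the conjugated operators `P_w` and their bracket condition
  set X₀W : Finset (Fin L) → PhaseSpace L → PhaseSpace L := fun w y => Fw w (P.drift L ((Fw w).symm y))
    with hX₀W
  set XW : Finset (Fin L) → Fin 2 → PhaseSpace L → PhaseSpace L :=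
    fun w b y => Fw w (P.bathField hL0 T_L T_R b ((Fw w).symm y)) with hXW
  have hX₀Ws : ∀ w, ContDiff ℝ ∞ (X₀W w) := fun w => contDiff_conj_equiv (Fw w) hY
  have hXWs : ∀ w b, ContDiff ℝ ∞ (XW w b) := fun w b => contDiff_conj_equiv (Fw w) (hX b)
  have hgen : ∀ w, IsBracketGenerating (fun o : Option (Fin 2) => o.elim (X₀W w) (XW w)) univ := fun w =>
    isBracketGenerating_conj_equiv_elim hY hX (Fw w) (isBracketGenerating_driftFamily P hU hV hL0 hγTL hV2)
  -- the coupled system solved by the conjugates `u ∘ ·^w`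
  haveI := isAddHaarMeasure_volume_phaseSpace L
  have hloc : ∀ w, LocallyIntegrable (fun x => u (Φ w x)) volume := fun w =>
    locallyIntegrable_comp_of_exp_bound hum hub (continuous_multiFlip Φ hΦ w)
  have hfs : ∀ w, ContDiff ℝ ∞ (fun x => F (Φ w x)) := fun w => by
    have e : (fun x => F (Φ w x)) = fun x => F (Fw w x) := by simp only [hFw]
    rw [e]
    exact hF.comp (Fw w).contDiff
  have hsys : ∀ (w : Finset (Fin L)) (φ : PhaseSpace L → ℝ), ContDiff ℝ ∞ φ → HasCompactSupport φ →
      ∫ x, u (Φ w x) * hormanderTranspose (X₀W w) (XW w) (fun _ => 0) φ x =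
        (∫ x, F (Φ w x) * φ x) + ∑ w', (ε * L * (if w' = w then 1 else 0) -
          ε * ∑ i : Fin L, (if w' = symmDiff w {i} then 1 else 0)) * ∫ x, u (Φ w' x) * φ x := by
    intro w φ hφ hφc
    rw [flip_coupling_sum ε (ε * L) w fun w' => ∫ x, u (Φ w' x) * φ x]
    exact flip_weak_conj hL hTL hTR hγ Φ hΦ hum hub hweak w (Fw w) (hFw w) hφ hφc
  obtain ⟨g, hg, hug⟩ := exists_smooth_ae_eq_of_coupledSystem (volume : Measure (PhaseSpace L)) hX₀Ws hXWs
    (fun _ => contDiff_const) hgen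
    (fun w w' => ε * L * (if w' = w then 1 else 0) - ε * ∑ i : Fin L, (if w' = symmDiff w {i} then 1 else 0))
    hloc hfs hsys ∅
  refine ⟨g, hg, ?_⟩
  have e : (fun x => u (Φ ∅ x)) = u := funext fun x => by rw [multiFlip_empty Φ hΦ]
  rw [e] at hug
  exact hug

end Summit.AtomisticToContinuum.FouriersLaw.Theorems.VanishingNoiseBound

end
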